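import Summits.BirchSwinnertonDyer.BirchSwinnertonDyer.Theorems.ErratumRoadFiveIMCDivMemberCongruenceErratumTame
import Literature.NumberTheory.EllipticCurves.Castella2018.SigmaSelmerUnramifiedOutsideSProofs
import HarnessLib

/-!
# Route `UniversalToricDescent`, crux `TwinSplitIMCAtThreeMult` (item stmt-BirchSwinnertonDyer-20694, bucket B),
# line `threeframes`, stub `stub_wanFrameMult` via the member tower (crux idea `member-tower-fitting-limit`):
# the Road-FF member congruence `e_m` at ANY ODD PRIME `p ≥ 3` (the tree's kernel had `5 ≤ p`)

Cell `bsd-wall` (run/shared/lean/pub/bsd-wall/), seat `bsd-wall-utd-p2` (lead prover g11, 2026-08-28);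
`--supports stmt-BirchSwinnertonDyer-20694 --as helper`; Theses-free.

## Why this file exists

The crux idea `member-tower-fitting-limit` (utd-idea g18; `Cruxes/TwinSplitIMCAtThreeMult/Ideas/`) derives the
rational Wan frame of the 3-multiplicative twin (`stub_wanFrameMult` of line `threeframes` = act D's ♭B) from a
Hida MEMBER TOWER by the tree's binder-generic Road-FF recombination (cell `bsd-stepL`, crux 20169, `p ≥ 5`).
The ONE step of that machine whose tree form carries `5 ≤ p` is the member congruence
`e_m : (𝒪_m⟦T⟧ ⊗_Λ X^Σ_ac(E/K_∞)) ⧸ (p^m) ≃ X^Σ_ac(A_{g_m}) ⧸ (p^m)`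
(`RoadFFMember.nonempty_memberCongruence_erratum_tame`, p ≥ 5), and the ONLY place `5 ≤ p` enters its cone is
the binder of the `Σ`-bridge named fact `Castella2018.selmerBig_eq_selmerBigDecomp_of_unramifiedOutside` — whose
tree PROOF (`…_holds`, `SigmaSelmerUnramifiedOutsideSProofs`) uses `p ≠ 2` only. This file re-runs that cone
at `3 ≤ p`:

* §1 `selmerBig_eq_selmerBigDecomp_of_unramifiedOutside_odd` — the `Σ`-bridge for every `p ≠ 2`, no `Irr`,
  no hypothesis on `K` (same proof as the Literature `…_holds`).
* §2 `nonempty_XAc_equiv_XBig_odd` — (F1) `X^Σ_ac(E[p^∞]) ≃ₗ[Λ] XBig κ ρ_E 𝔮 Σ` at `3 ≤ p` from Shapiro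
  ([SU14] Prop. 3.2.3, named fact `prop323_XAc_equiv_XBigDecomp`, whose own binder is `3 ≤ p`) and §1.
* §3 `nonempty_memberCongruence_tame_odd`, `nonempty_memberCongruence_odd_of_facts` — the member congruence
  `e_m` at `3 ≤ p` for a Hida member `D : HidaCongruentMember W p m` of `f_E` (`p ∥ N`), with the tame
  `Σ`-hypothesis `hSM : w ∉ Σ → N/p ∉ w`, the local input (dec) `E(ℚ_p)[p] = 0` at the X-slot `𝔮 ∣ p` of
  degree one, `E[p]` irreducible, `K` imaginary quadratic with `p` split; proof = the tree's
  `nonempty_memberCongruence_erratum_tame` with (F1) replaced by §2.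

HONEST FRAMING: theorems only (no definition, no named fact, no instance, no `sorry`); CONDITIONAL on the named
facts displayed as hypotheses (`prop323_XAc_equiv_XBigDecomp`, (SelBC) `selmerBig_extendScalars_equiv_baseChange`,
both PUBLISHED) — nothing is booked; the anticyclotomic main conjecture is asserted nowhere; BSD is proved for no
curve; no census number moves. At `p = 3` the consumer is the twin line (file
`UniversalToricDescentRoadFFDescentOdd`, same seat).

References: [Castella2018] §2.2, Thm. 2.6 (arXiv:1704.06608 p. 7); [Castella2018Erratum] Thm. 1.1, (b), Lemma 2.1 and
proof of Thm. 1.1 (pp. 1–4); [Skinner2016PacificMC] §2.3 (p. 179), §2.6 (2-6-1) (`p ≥ 3`), §3.1 (p. 192);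
[SkinnerUrban2014] Prop. 3.2.3, Lemma 3.1.9.
-/

set_option autoImplicit false

noncomputable section

open scoped TensorProduct Classical

open CategoryTheory PowerSeries NumberField IsDedekindDomain Field WeierstrassCurve
open Literature.NumberTheory.GaloisRepresentations Literature.NumberTheory.EllipticCurves
  Literature.NumberTheory.EllipticCurves.BigGaloisRep Literature.NumberTheory.EllipticCurves.GreenbergSelmer
  Literature.NumberTheory.EllipticCurves.Skinner2016 Literature.NumberTheory.EllipticCurves.Rank1Residual
  Literature.NumberTheory.EllipticCurves.Rank1Residual.Typed Literature.NumberTheory.EllipticCurves.ModularForms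
  Literature.NumberTheory.EllipticCurves.Castella2018
open Summit.BirchSwinnertonDyer.Rank1Residual.X11b.Halves Summit.BirchSwinnertonDyer.Rank1Residual.X11b.AcSelmer

namespace Summit.BirchSwinnertonDyer.Rank1Residual.X11b.RoadFFMember

/-! ### §1 The `Σ`-bridge at every odd prime -/

/-- **Castella 2018 §2.2 / Erratum proof of Lemma 2.1 at every ODD prime**: for `E/ℚ`, `p ≠ 2`, `K` a number
field, `𝔭` a prime of `K`, `Σ` a set of places `w ∤ p` outside which (away from `p`) inertia acts trivially on
`E[p^∞]`, and `κ` a `ℤ_p`-extension, the inertia-strict and decomposition-strict Selmer groups of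
`T_pE ⊗ Λ^*(Ψ⁻¹)` coincide. Same proof as the Literature discharge
`selmerBig_eq_selmerBigDecomp_of_unramifiedOutside_holds` (which is stated under the fact's binder `5 ≤ p` but uses
`p ≠ 2` only: `ℋ^ur_w = 0` at the good `w ∉ Σ` by `resH1_anticyclotomicBigRep_localMap_inl_eq_zero_of_inr`).
[cite: Castella2018, §2.2 (the two sentences on ℋ^ur_v, ℋ^ur_w after Prop. 2.5) and Thm. 2.6 with its proof]
[cite: Castella2018Erratum, §2, proof of Lemma 2.1 (p. 2)] -/
theorem selmerBig_eq_selmerBigDecomp_of_unramifiedOutside_odd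
    (W : WeierstrassCurve ℚ) [W.IsElliptic] (p : ℕ) [Fact p.Prime] (hp2 : p ≠ 2)
    (K : Type) [Field K] [NumberField K] (𝔭 : HeightOneSpectrum (𝓞 K))
    (S : Set (HeightOneSpectrum (𝓞 K)))
    (hram : ∀ w : HeightOneSpectrum (𝓞 K), w ∉ S → ((p : ℕ) : 𝓞 K) ∉ w.asIdeal →
      ∀ (σ : LocalGroup K (Sum.inr w)) (P : PrimaryTorsion (geomPoints (W.baseChange K)) p),
        (W.baseChange K).primaryTorsionGaloisRep p (localMap K (Sum.inr w) σ) P = P)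
    (κ : ZpExtension K p) [TopologicalSpace (IwasawaAlgebra p)]
    [ContinuousSMul (IwasawaAlgebra p) (BigRepModule ℤ_[p] p (PrimaryTorsion (geomPoints (W.baseChange K)) p))] :
    selmerBig κ ((W.baseChange K).primaryTorsionGaloisRep p) 𝔭 S =
      selmerBigDecomp κ ((W.baseChange K).primaryTorsionGaloisRep p) 𝔭 S := by
  apply le_antisymm
  · intro x hx
    rw [mem_selmerBig_iff] at hx
    rw [selmerBigDecomp, mem_selmer_iff]
    rintro (w | w) hw
    · rcases (inl_mem_strictSetDecomp_iff p 𝔭 w S).1 hw with rfl | ⟨hwS, hwp⟩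
      · exact hx.1
      · exact resH1_anticyclotomicBigRep_localMap_inl_eq_zero_of_inr (W.baseChange K) p κ hp2 hwp
          (hram w hwS hwp) x (hx.2 w hwS hwp)
    · exact (inr_not_mem_strictSetDecomp p 𝔭 w S hw).elim
  · intro x hx
    rw [selmerBigDecomp, mem_selmer_iff] at hx
    rw [mem_selmerBig_iff]
    refine ⟨hx (Sum.inl 𝔭) ((inl_mem_strictSetDecomp_iff p 𝔭 𝔭 S).2 (Or.inl rfl)),
      fun w hwS hwp ↦ ?_⟩
    exact resH1_comp_eq_zero_of_resH1_eq_zero _ (localMap K (Sum.inl w)) (inertiaIncl K w) x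
      (hx (Sum.inl w) ((inl_mem_strictSetDecomp_iff p 𝔭 w S).2 (Or.inr ⟨hwS, hwp⟩)))

/-! ### §2 (F1) at `3 ≤ p`: `X^Σ_ac(E[p^∞]) ≃ₗ[Λ] XBig` from Shapiro and §1 -/

/-- **`hF1` at every `p ≥ 3`: `X^Σ_ac(E[p^∞]) ≃ₗ[Λ] XBig κ ρ_E 𝔮 Σ`** for
`ρ_E = (W.baseChange K).primaryTorsionGaloisRep p`, from Shapiro ([SU14] Prop. 3.2.3, named fact
`prop323_XAc_equiv_XBigDecomp`: `XAc ≃ₗ[Λ] XBigDecomp`, binder `3 ≤ p`) and the odd-prime `Σ`-bridge §1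
(`XBig`, `XBigDecomp` are the character modules of the two equal submodules). The tree's `nonempty_XAc_equiv_XBig`
is the same at `5 ≤ p` with the bridge as a named-fact binder. CONDITIONAL on `hSh`.
[cite: SkinnerUrban2014, Prop. 3.2.3] [cite: Castella2018, proof of Thm. 2.6 (the `Σ`-identification)] -/
theorem nonempty_XAc_equiv_XBig_odd (W : WeierstrassCurve ℚ) [W.IsElliptic] (p : ℕ) [Fact p.Prime]
    (K : Type) [Field K] [NumberField K] (hSh : SkinnerUrban2014.prop323_XAc_equiv_XBigDecomp)
    (hp : 3 ≤ p) (hK : IsImaginaryQuadratic K) (hsplit : SatisfiesHeegnerHypothesis p K)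
    (𝔮 : HeightOneSpectrum (𝓞 K)) (h𝔮 : ((p : ℕ) : 𝓞 K) ∈ 𝔮.asIdeal)
    (S : Set (HeightOneSpectrum (𝓞 K))) (hS : S.Finite) (hSp : ∀ w ∈ S, ((p : ℕ) : 𝓞 K) ∉ w.asIdeal)
    (hram : ∀ w : HeightOneSpectrum (𝓞 K), w ∉ S → ((p : ℕ) : 𝓞 K) ∉ w.asIdeal →
      ∀ (σ : LocalGroup K (Sum.inr w)) (P : PrimaryTorsion (geomPoints (W.baseChange K)) p),
        (W.baseChange K).primaryTorsionGaloisRep p (localMap K (Sum.inr w) σ) P = P)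
    (κ : ZpExtension K p) (hκ : κ.IsAnticyclotomic) (γ : absoluteGaloisGroup K) [Fact (κ.IsTopGenerator γ)]
    [TopologicalSpace (IwasawaAlgebra p)]
    [ContinuousSMul (IwasawaAlgebra p) (BigRepModule ℤ_[p] p (PrimaryTorsion (geomPoints (W.baseChange K)) p))] :
    Nonempty (AcSelmer.XAc (W.baseChange K) p κ 𝔮 S γ ≃ₗ[IwasawaAlgebra p]
      XBig κ ((W.baseChange K).primaryTorsionGaloisRep p) 𝔮 S) := by
  obtain ⟨e⟩ := hSh W p hp K hK hsplit 𝔮 h𝔮 S hS hSp κ hκ γ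
  have hp2 : p ≠ 2 := by omega
  have hEq := selmerBig_eq_selmerBigDecomp_of_unramifiedOutside_odd W p hp2 K 𝔮 S hram κ
  have f : XBigDecomp κ ((W.baseChange K).primaryTorsionGaloisRep p) 𝔮 S ≃ₗ[IwasawaAlgebra p]
      XBig κ ((W.baseChange K).primaryTorsionGaloisRep p) 𝔮 S :=
    CharacterModule.congr (LinearEquiv.ofEq _ _ hEq.symm)
  exact ⟨e.trans f⟩

/-! ### §3 The member congruence `e_m` at `3 ≤ p` -/

section Member

variable {W : WeierstrassCurve ℚ} [W.IsElliptic] [W.IsGloballyMinimal] {p : ℕ} [Fact p.Prime] {m : ℕ}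
  {K : Type} [Field K] [NumberField K]

/-- **THE MEMBER CONGRUENCE `e_m` AT EVERY `p ≥ 3` (tame `Σ`-hypothesis).** For a Hida member `D` of `f_E` at
level `m ≥ 1` with coefficient ring `𝒪_m`, `E[p]` irreducible, `K` imaginary quadratic with `p` split, the X-slot
`𝔮 ∣ p` of degree one (`φ : K_𝔮 →+* ℚ_p`), (dec) `E(ℚ_p)[p] = 0`, `Σ` finite away from `p` containing the bad
places and those above `N/p`:
`((𝒪_m⟦T⟧ ⊗_Λ X^Σ_𝔮(E/K_∞)) ⧸ ((C p)Λ·𝒪_m⟦T⟧)^m) ≃ₗ[𝒪_m⟦T⟧] (XBig κ (A_{g_m}|_{Γ_K}) 𝔮 Σ ⧸ ((C p)Λ·𝒪_m⟦T⟧)^m)`.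
Statement and proof = the tree's `nonempty_memberCongruence_erratum_tame` (p ≥ 5) with (F1) taken from §2, so that
the only change is the binder `3 ≤ p`. CONDITIONAL on the named facts `hSh` and (SelBC) `hSelBC` and on (Frob)
`t₀, b, b'`. Nothing is booked. [cite: Castella2018Erratum, Thm. 1.1, (b), Lemma 2.1 and proof of Thm. 1.1 (pp. 1–4)]
[cite: Skinner2016PacificMC, §2.6 (2-6-1) (standing `p ≥ 3`), §3.1 (b)(d)] [cite: SkinnerUrban2014, Prop. 3.2.3] -/
theorem nonempty_memberCongruence_tame_odd (hSh : SkinnerUrban2014.prop323_XAc_equiv_XBigDecomp)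
    (hp : 3 ≤ p) (hirr : Irr W p) (hK : IsImaginaryQuadratic K) (hsplit : SatisfiesHeegnerHypothesis p K)
    (𝔮 : HeightOneSpectrum (𝓞 K)) (h𝔮 : ((p : ℕ) : 𝓞 K) ∈ 𝔮.asIdeal) (φ : 𝔮.adicCompletion K →+* ℚ_[p])
    (hiv : ∀ Q : (W.baseChange ℚ_[p]).toAffine.Point, p • Q = 0 → Q = 0)
    (S : Set (HeightOneSpectrum (𝓞 K))) (hSfin : S.Finite) (hSp : ∀ w ∈ S, ((p : ℕ) : 𝓞 K) ∉ w.asIdeal)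
    (hS : ∀ w : HeightOneSpectrum (𝓞 K), w ∉ S → ((p : ℕ) : 𝓞 K) ∉ w.asIdeal →
      (W.baseChange K).HasGoodReductionAt w)
    (hSM : ∀ w : HeightOneSpectrum (𝓞 K), w ∉ S → ((W.conductorNorm ℤ / p : ℕ) : 𝓞 K) ∉ w.asIdeal)
    (κ : ZpExtension K p) (hκ : κ.IsAnticyclotomic) (γ : absoluteGaloisGroup K) [Fact (κ.IsTopGenerator γ)]
    (D : HidaCongruentMember W p m) (hm : 1 ≤ m)
    [TopologicalSpace (IwasawaAlgebra p)]
    [ContinuousSMul (IwasawaAlgebra p) (BigRepModule ℤ_[p] p (PrimaryTorsion (geomPoints (W.baseChange K)) p))]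
    [TopologicalSpace (PowerSeries (padicCoeffIntegers D.ι))]
    [ContinuousSMul (PowerSeries (padicCoeffIntegers D.ι)) (BigRepModule (padicCoeffIntegers D.ι) p
      (CoeffExtension ℤ_[p] (padicCoeffIntegers D.ι) (PrimaryTorsion (geomPoints (W.baseChange K)) p)))]
    [ContinuousSMul (PowerSeries (padicCoeffIntegers D.ι)) (BigRepModule (padicCoeffIntegers D.ι) p
      (Cofree D.Δ.ρ (padicCoeffField D.ι)))]
    (hSelBC : Nonempty (selmerBig κ (ContinuousRep.extendScalars (R := ℤ_[p]) (G := absoluteGaloisGroup K)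
        (A := PrimaryTorsion (geomPoints (W.baseChange K)) p) (padicCoeffIntegers D.ι)
        ((W.baseChange K).primaryTorsionGaloisRep p)) 𝔮 S ≃ₗ[PowerSeries (padicCoeffIntegers D.ι)]
      PowerSeries (padicCoeffIntegers D.ι) ⊗[IwasawaAlgebra p]
        selmerBig κ ((W.baseChange K).primaryTorsionGaloisRep p) 𝔮 S))
    {ι' : Type*} [Fintype ι'] (t₀ : padicCoeffIntegers D.ι →ₗ[ℤ_[p]] ℤ_[p]) (b b' : ι' → padicCoeffIntegers D.ι)
    (hfb : ∀ a : padicCoeffIntegers D.ι, a = ∑ i, t₀ (a * b' i) • b i)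
    (hfb' : ∀ a : padicCoeffIntegers D.ι, a = ∑ i, t₀ (a * b i) • b' i) :
    Nonempty ((((PowerSeries (padicCoeffIntegers D.ι)) ⊗[IwasawaAlgebra p]
          AcSelmer.XAc (W.baseChange K) p κ 𝔮 S γ) ⧸
        (((Ideal.span {(C (p : ℤ_[p]) : IwasawaAlgebra p)}).map
            (algebraMap (IwasawaAlgebra p) (PowerSeries (padicCoeffIntegers D.ι)))) ^ m •
          (⊤ : Submodule (PowerSeries (padicCoeffIntegers D.ι))
            ((PowerSeries (padicCoeffIntegers D.ι)) ⊗[IwasawaAlgebra p] AcSelmer.XAc (W.baseChange K) p κ 𝔮 S γ))))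
        ≃ₗ[PowerSeries (padicCoeffIntegers D.ι)]
      (XBig κ (D.Δ.cofreeRepOver K) 𝔮 S ⧸
        (((Ideal.span {(C (p : ℤ_[p]) : IwasawaAlgebra p)}).map
            (algebraMap (IwasawaAlgebra p) (PowerSeries (padicCoeffIntegers D.ι)))) ^ m •
          (⊤ : Submodule (PowerSeries (padicCoeffIntegers D.ι)) (XBig κ (D.Δ.cofreeRepOver K) 𝔮 S))))) := by
  haveI : Module.Free ℤ_[p] (padicCoeffIntegers D.ι) := moduleFree_of_frobData D.ι t₀ b b' hfb
  -- (unr): inertia at every `w ∉ Σ`, `w ∤ p` acts trivially on `E_K[p^∞]` (good reduction there)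
  have hunr : ∀ w : HeightOneSpectrum (𝓞 K), w ∉ S → ((p : ℕ) : 𝓞 K) ∉ w.asIdeal →
      ∀ σ : absoluteGaloisGroup (w.adicCompletion K), σ ∈ absInertia (w.adicCompletion K) →
        ∀ P : PrimaryTorsion (geomPoints (W.baseChange K)) p,
          absGaloisRestrict K (w.adicCompletion K) σ • P = P :=
    fun w hw hpw σ hσ P =>
      BigRep.smul_primaryTorsion_eq_of_mem_absInertia_of_hasGoodReductionAt (W.baseChange K) p (hS w hw hpw)
        hpw hσ P
  -- (F1) at `3 ≤ p`
  have hF1 := nonempty_XAc_equiv_XBig_odd W p K hSh hp hK hsplit 𝔮 h𝔮 S hSfin hSp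
    (fun w hw hpw σ P => by
      obtain ⟨σ, hσ⟩ := σ
      rw [WeierstrassCurve.primaryTorsionGaloisRep_apply]
      exact hunr w hw hpw σ hσ P)
    κ hκ γ
  exact nonempty_memberCongruence κ m ((W.baseChange K).primaryTorsionGaloisRep p)
    (ContinuousRep.extendScalars (R := ℤ_[p]) (G := absoluteGaloisGroup K)
      (A := PrimaryTorsion (geomPoints (W.baseChange K)) p) (padicCoeffIntegers D.ι)
      ((W.baseChange K).primaryTorsionGaloisRep p))
    (D.Δ.cofreeRepOver K) 𝔮 S hF1 hSelBC t₀ b b' hfb hfb' (exists_torsionCongruence_baseChange D K)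
    (hdiv_extendScalars_erratum K (padicCoeffIntegers D.ι) (W := W))
    (hglob_extendScalars_erratum K (padicCoeffIntegers D.ι) κ hK hirr m hm)
    (hloc_extendScalars (padicCoeffIntegers D.ι) (W.baseChange K) κ 𝔮 S (geomPoints_baseChange_divisible K (W := W))
      (BigRep.hdec_geomPoints_of_padicTorsion W p K 𝔮 φ hiv) hunr m hm)
    (hdiv_cofreeRepOver D.Δ)
    (hglob_cofreeRepOver_erratum D K hm κ hK hirr m hm)
    (hloc_cofreeRepOver D K hm κ 𝔮 S (BigRep.hdec_geomPoints_of_padicTorsion W p K 𝔮 φ hiv) hSM m hm)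

/-- **`e_m` at every `p ≥ 3` from the NAMED FACTS (F1 = `hSh`) and (SelBC = `hSelBC`), with (Frob) and
`Module.Free/Finite ℤ_p 𝒪_m` discharged by defn-ty1's (T1)** (`HidaCongruentForm.exists_frobeniusData`,
`moduleFree_coeffRing`, `moduleFinite_coeffRing`; needs `N/p ≠ 0`). Same conclusion as
`nonempty_memberCongruence_tame_odd`; the tree's `nonempty_memberCongruence_erratum_of_facts` is the case `5 ≤ p`.
CONDITIONAL on the two named facts; nothing booked. [cite: Castella2018Erratum, (b), Lemma 2.1 and proof of Thm. 1.1 (p. 4)]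
[cite: Skinner2016PacificMC, §2.3 (p. 179), §2.6 (2-6-1)] [cite: SkinnerUrban2014, Prop. 3.2.3] -/
theorem nonempty_memberCongruence_odd_of_facts (hSh : SkinnerUrban2014.prop323_XAc_equiv_XBigDecomp)
    (hSelBC : Skinner2016.selmerBig_extendScalars_equiv_baseChange)
    (hp : 3 ≤ p) (hirr : Irr W p) (hK : IsImaginaryQuadratic K) (hsplit : SatisfiesHeegnerHypothesis p K)
    (𝔮 : HeightOneSpectrum (𝓞 K)) (h𝔮 : ((p : ℕ) : 𝓞 K) ∈ 𝔮.asIdeal) (φ : 𝔮.adicCompletion K →+* ℚ_[p])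
    (hiv : ∀ Q : (W.baseChange ℚ_[p]).toAffine.Point, p • Q = 0 → Q = 0)
    (S : Set (HeightOneSpectrum (𝓞 K))) (hSfin : S.Finite) (hSp : ∀ w ∈ S, ((p : ℕ) : 𝓞 K) ∉ w.asIdeal)
    (hS : ∀ w : HeightOneSpectrum (𝓞 K), w ∉ S → ((p : ℕ) : 𝓞 K) ∉ w.asIdeal →
      (W.baseChange K).HasGoodReductionAt w)
    (hSM : ∀ w : HeightOneSpectrum (𝓞 K), w ∉ S → ((W.conductorNorm ℤ / p : ℕ) : 𝓞 K) ∉ w.asIdeal)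
    (κ : ZpExtension K p) (hκ : κ.IsAnticyclotomic) (γ : absoluteGaloisGroup K) [Fact (κ.IsTopGenerator γ)]
    (D : HidaCongruentMember W p m) (hm : 1 ≤ m) [NeZero (W.conductorNorm ℤ / p)]
    [TopologicalSpace (IwasawaAlgebra p)]
    [ContinuousSMul (IwasawaAlgebra p) (BigRepModule ℤ_[p] p (PrimaryTorsion (geomPoints (W.baseChange K)) p))]
    [TopologicalSpace (PowerSeries (padicCoeffIntegers D.ι))]
    [ContinuousSMul (PowerSeries (padicCoeffIntegers D.ι)) (BigRepModule (padicCoeffIntegers D.ι) p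
      (CoeffExtension ℤ_[p] (padicCoeffIntegers D.ι) (PrimaryTorsion (geomPoints (W.baseChange K)) p)))]
    [ContinuousSMul (PowerSeries (padicCoeffIntegers D.ι)) (BigRepModule (padicCoeffIntegers D.ι) p
      (Cofree D.Δ.ρ (padicCoeffField D.ι)))] :
    Nonempty ((((PowerSeries (padicCoeffIntegers D.ι)) ⊗[IwasawaAlgebra p]
          AcSelmer.XAc (W.baseChange K) p κ 𝔮 S γ) ⧸
        (((Ideal.span {(C (p : ℤ_[p]) : IwasawaAlgebra p)}).map
            (algebraMap (IwasawaAlgebra p) (PowerSeries (padicCoeffIntegers D.ι)))) ^ m •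
          (⊤ : Submodule (PowerSeries (padicCoeffIntegers D.ι))
            ((PowerSeries (padicCoeffIntegers D.ι)) ⊗[IwasawaAlgebra p] AcSelmer.XAc (W.baseChange K) p κ 𝔮 S γ))))
        ≃ₗ[PowerSeries (padicCoeffIntegers D.ι)]
      (XBig κ (D.Δ.cofreeRepOver K) 𝔮 S ⧸
        (((Ideal.span {(C (p : ℤ_[p]) : IwasawaAlgebra p)}).map
            (algebraMap (IwasawaAlgebra p) (PowerSeries (padicCoeffIntegers D.ι)))) ^ m •
          (⊤ : Submodule (PowerSeries (padicCoeffIntegers D.ι)) (XBig κ (D.Δ.cofreeRepOver K) 𝔮 S))))) :=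
  haveI : Module.Free ℤ_[p] (padicCoeffIntegers D.ι) := D.moduleFree_coeffRing
  haveI : Module.Finite ℤ_[p] (padicCoeffIntegers D.ι) := D.moduleFinite_coeffRing
  D.exists_frobeniusData.elim fun _n h => h.elim fun t₀ h => h.elim fun b h => h.elim fun b' h =>
    nonempty_memberCongruence_tame_odd hSh hp hirr hK hsplit 𝔮 h𝔮 φ hiv S hSfin hSp hS hSM κ hκ γ D hm
      (Skinner2016.nonempty_selmerBig_primaryTorsion_extendScalars_equiv W κ (padicCoeffIntegers D.ι) 𝔮 S hSelBC)
      t₀ b b' h.1 h.2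

end Member

end Summit.BirchSwinnertonDyer.Rank1Residual.X11b.RoadFFMember

end
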